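import Literature.Computability.Complexity.StackPrograms
import HarnessLib

/-!
# Verified arithmetic on stack programs, I: bit strings, register utilities, addition, subtraction

Trunk `CplxCore`, toolkit for `TimeBounds.lean`, continuing `StackPrograms.lean`: a library of
structured stack programs (`Com`) with proved functional specifications and step bounds
(`Com.Runs`), from which polynomial-time machines are assembled (`Com.mem_FP`). Numbers are bit
strings, least significant bit first (`bitsToNat` of `BoolEncodings.lean`; `norm` removes the redundant high zeros and is
Mathlib's `encodeNat` of the value, `norm_eq_encodeNat`).

* Generic utilities over any register type: `clear`, `pour` (move, reversing), `move`, `copy`,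
  with exact effects (`runs_clear`, `runs_pour`, `runs_move`, `runs_copy`).
* The arithmetic register bank `AReg` (eight registers `x y z s t u f g`) and its programs:
  `normalize` (`x := norm x`), `add` (`x := x + y`), `sub` (`x := x - y` if `x ≥ y`, with the
  comparison flag in `g`; `x` unchanged otherwise) — each with a functional model, a simulation
  theorem (`runs_normalize`, `runs_add`, `runs_sub`) and the arithmetic of the model
  (`bitsToNat_addBits`, `bitsToNat_subBits`, …). Callers embed the bank into their register type with
  `Com.map Sum.inl` (`Com.Runs.inl`).

Multiplication, division and modular exponentiation are built on top of this file in the same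
style (they are not needed here).

## References

* D. E. Knuth, *The Art of Computer Programming*, Vol. 2, 3rd ed., Addison-Wesley 1998, §4.3.1
  (classical algorithms for multiple-precision addition and subtraction, Algorithms A and S).
  (Not held; the algorithms are the schoolbook ones and are fully proved here.)
* T. Nipkow, G. Klein, *Concrete Semantics*, Springer 2014, Ch. 7 (reasoning with big-step
  semantics).
-/

namespace Literature.Computability.Complexity

open _root_.Computability

/-! ### Bit strings as numbers: normal form -/

/-- Normal form: remove the redundant most significant zeros. [folklore] -/
def norm : List Bool → List Bool
  | [] => []
  | b :: w => match norm w with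
    | [] => if b then [true] else []
    | c :: w' => b :: c :: w'

/-- `norm` of the empty string. [folklore] -/
@[simp] theorem norm_nil : norm [] = [] := rfl

/-- `norm` in terms of the normal form of the tail. [folklore] -/
theorem norm_cons (b : Bool) (w : List Bool) :
    norm (b :: w) = if norm w = [] then (if b then [true] else []) else b :: norm w := by
  rw [norm]
  cases norm w <;> simp

/-- Normalising preserves the value. [folklore] -/
@[simp] theorem bitsToNat_norm (w : List Bool) : bitsToNat (norm w) = bitsToNat w := by
  induction w with
  | nil => rfl
  | cons b w ih =>
    rw [norm_cons]
    by_cases h : norm w = []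
    · rw [h] at ih
      simp only [bitsToNat_nil] at ih
      cases b <;> simp [h, ← ih]
    · simp [h, ih]

/-- The normal form is empty iff the value is `0`. [folklore] -/
theorem norm_eq_nil_iff (w : List Bool) : norm w = [] ↔ bitsToNat w = 0 := by
  induction w with
  | nil => simp
  | cons b w ih =>
    rw [norm_cons]
    by_cases h : norm w = []
    · have := ih.1 h
      cases b <;> simp [h, this]
    · have : bitsToNat w ≠ 0 := fun h0 => h (ih.2 h0)
      simp [h]; omega

/-- The normal form is not longer. [folklore] -/
theorem length_norm_le (w : List Bool) : (norm w).length ≤ w.length := by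
  induction w with
  | nil => simp
  | cons b w ih =>
    rw [norm_cons]
    split
    · cases b <;> simp
    · simp [ih]

/-- The normal form is the string with its trailing (most significant) zeros removed:
`w = norm w ++ zeros`. [folklore] -/
theorem exists_eq_norm_append (w : List Bool) : ∃ n, w = norm w ++ List.replicate n false := by
  induction w with
  | nil => exact ⟨0, rfl⟩
  | cons b w ih =>
    obtain ⟨n, hn⟩ := ih
    rw [norm_cons]
    by_cases h : norm w = []
    · have hw : w = List.replicate n false := by rw [hn, h, List.nil_append]
      rw [if_pos h]
      cases b
      · refine ⟨n + 1, ?_⟩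
        rw [hw]
        simp [List.replicate_succ]
      · exact ⟨n, by rw [hw]; simp⟩
    · refine ⟨n, ?_⟩
      rw [if_neg h, List.cons_append, ← hn]

/-- A normal form does not end in `false`: it is empty or its last bit is `true`. [folklore] -/
theorem norm_eq_nil_or_getLast (w : List Bool) :
    norm w = [] ∨ ∃ v, norm w = v ++ [true] := by
  induction w with
  | nil => exact Or.inl rfl
  | cons b w ih =>
    rw [norm_cons]
    by_cases h : norm w = []
    · cases b
      · exact Or.inl (by simp [h])
      · exact Or.inr ⟨[], by simp [h]⟩
    · rcases ih with h' | ⟨v, hv⟩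
      · exact absurd h' h
      · exact Or.inr ⟨b :: v, by simp [hv]⟩

/-- Two strings not ending in `false` with the same value are equal. [folklore] -/
theorem eq_of_bitsToNat_eq_of_canonical :
    ∀ (v w : List Bool), (v = [] ∨ ∃ v', v = v' ++ [true]) → (w = [] ∨ ∃ w', w = w' ++ [true]) →
      bitsToNat v = bitsToNat w → v = w
  | [], [], _, _, _ => rfl
  | [], b :: w, _, hw, h => by
    exfalso
    rcases hw with hw | ⟨w', hw'⟩
    · simp at hw
    · have h0 : bitsToNat (w' ++ [true]) = 0 := by rw [← hw', ← h]; rfl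
      rw [bitsToNat_append] at h0
      have hp : 0 < 2 ^ w'.length := Nat.two_pow_pos _
      simp at h0
  | b :: v, [], hv, _, h => by
    exfalso
    rcases hv with hv | ⟨v', hv'⟩
    · simp at hv
    · have h0 : bitsToNat (v' ++ [true]) = 0 := by rw [← hv', h]; rfl
      rw [bitsToNat_append] at h0
      have hp : 0 < 2 ^ v'.length := Nat.two_pow_pos _
      simp at h0
  | b :: v, c :: w, hv, hw, h => by
    simp only [bitsToNat_cons] at h
    have hbc : b = c := by
      cases b <;> cases c <;> simp at h ⊢ <;> omega
    subst hbc
    have hvw : bitsToNat v = bitsToNat w := by cases b <;> simp at h <;> omega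
    have hv' : v = [] ∨ ∃ v', v = v' ++ [true] := by
      rcases hv with hv | ⟨v', hv'⟩
      · simp at hv
      · cases v' with
        | nil => simp at hv'; exact Or.inl hv'.2
        | cons d v' =>
          simp only [List.cons_append, List.cons.injEq] at hv'
          exact Or.inr ⟨v', hv'.2⟩
    have hw' : w = [] ∨ ∃ w', w = w' ++ [true] := by
      rcases hw with hw | ⟨w', hw'⟩
      · simp at hw
      · cases w' with
        | nil => simp at hw'; exact Or.inl hw'.2
        | cons d w' =>
          simp only [List.cons_append, List.cons.injEq] at hw'
          exact Or.inr ⟨w', hw'.2⟩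
    rw [eq_of_bitsToNat_eq_of_canonical v w hv' hw' hvw]

/-- Mathlib's binary numerals do not end in `false`. [folklore] -/
theorem encodeNat_canonical (n : ℕ) : encodeNat n = [] ∨ ∃ v, encodeNat n = v ++ [true] := by
  have key : ∀ m : PosNum, ∃ v, encodePosNum m = v ++ [true] := by
    intro m
    induction m with
    | one => exact ⟨[], rfl⟩
    | bit0 m ih => obtain ⟨v, hv⟩ := ih; exact ⟨false :: v, by simp [encodePosNum, hv]⟩
    | bit1 m ih => obtain ⟨v, hv⟩ := ih; exact ⟨true :: v, by simp [encodePosNum, hv]⟩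
  unfold encodeNat encodeNum
  cases (n : Num) with
  | zero => exact Or.inl rfl
  | pos m => exact Or.inr (key m)

/-- **The normal form of a bit string is Mathlib's binary numeral of its value.** [folklore] -/
theorem norm_eq_encodeNat (w : List Bool) : norm w = encodeNat (bitsToNat w) :=
  eq_of_bitsToNat_eq_of_canonical _ _ (norm_eq_nil_or_getLast w) (encodeNat_canonical _) (by simp)

/-- In particular `norm (encodeNat n) = encodeNat n`. [folklore] -/
@[simp] theorem norm_encodeNat (n : ℕ) : norm (encodeNat n) = encodeNat n := by
  rw [norm_eq_encodeNat, bitsToNat_encodeNat]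

/-- The length of `norm w` is the binary size of the value. [folklore] -/
theorem length_norm (w : List Bool) : (norm w).length = (bitsToNat w).size := by
  rcases norm_eq_nil_or_getLast w with h | ⟨v, hv⟩
  · rw [h, (norm_eq_nil_iff w).1 h]; rfl
  · have hval : bitsToNat w = bitsToNat v + 2 ^ v.length := by
      rw [← bitsToNat_norm w, hv, bitsToNat_append]; simp
    rw [hv, hval, List.length_append, List.length_singleton]
    have h1 := bitsToNat_lt v
    apply le_antisymm
    · exact Nat.lt_size.2 (by omega)
    · refine Nat.size_le.2 ?_
      rw [pow_succ]; omega

/-! ### Generic register utilities -/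

namespace Com

section Generic

variable {ι : Type} [DecidableEq ι]

/-- Repackaging a run: equal final registers, larger budget. [folklore] -/
theorem Runs.of_eq {c : Com ι} {R R₁ R' : Regs ι} {B₁ B : ℕ} (h : Runs c R R₁ B₁) (hR : R₁ = R')
    (hB : B₁ ≤ B) : Runs c R R' B := (h.congr hR).mono hB

/-- `clear a`: empty register `a`. [folklore] -/
def clear (a : ι) : Com ι := loop a skip skip

/-- `clear a` empties `a` in `2|a| + 1` steps. [folklore] -/
theorem runs_clear (a : ι) (R : Regs ι) :
    Runs (clear a) R (Function.update R a []) (2 * (R a).length + 1) := by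
  suffices h : ∀ (w : List Bool) (R : Regs ι), R a = w →
      Runs (clear a) R (Function.update R a []) (2 * w.length + 1) from h _ R rfl
  intro w
  induction w with
  | nil => intro R h; exact (Runs.loop_nil skip skip h).of_eq (by rw [← h, Function.update_eq_self]) le_rfl
  | cons b w ih =>
    intro R h
    cases b
    · exact (Runs.loop_false h (Runs.skip _) (ih _ (by simp))).of_eq (by simp) (by simp; omega)
    · exact (Runs.loop_true h (Runs.skip _) (ih _ (by simp))).of_eq (by simp) (by simp; omega)

/-- `pour a b`: move the contents of `a` onto `b`, bit by bit (so reversed). [folklore] -/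
def pour (a b : ι) : Com ι := loop a (push b true) (push b false)

/-- `pour a b` empties `a` and puts `reverse a` on top of `b`, in `3|a| + 1` steps. [folklore] -/
theorem runs_pour {a b : ι} (hab : a ≠ b) (R : Regs ι) :
    Runs (pour a b) R (Function.update (Function.update R a []) b ((R a).reverse ++ R b))
      (3 * (R a).length + 1) := by
  suffices h : ∀ (w : List Bool) (R : Regs ι), R a = w →
      Runs (pour a b) R (Function.update (Function.update R a []) b (w.reverse ++ R b))
        (3 * w.length + 1) by simpa using h _ R rfl
  intro w
  induction w with
  | nil =>
    intro R h
    refine (Runs.loop_nil _ _ h).of_eq ?_ le_rfl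
    ext i : 1
    simp only [Function.update_apply, List.reverse_nil, List.nil_append]
    split_ifs <;> simp_all
  | cons c w ih =>
    intro R h
    have hstep : ∀ c : Bool, Runs (push b c) (Function.update R a w)
        (Function.update (Function.update R a w) b (c :: R b)) 1 := fun c => by
      simpa [Function.update_of_ne hab.symm] using Runs.push b c (Function.update R a w)
    have hih : ∀ c : Bool, Runs (pour a b) (Function.update (Function.update R a w) b (c :: R b))
        (Function.update (Function.update R a []) b ((c :: w).reverse ++ R b)) (3 * w.length + 1) := by
      intro c
      refine (ih _ (by simp [Function.update_of_ne hab])).of_eq ?_ le_rfl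
      ext i : 1
      simp only [Function.update_apply]
      split_ifs <;> simp_all
    cases c
    · exact (Runs.loop_false h (hstep false) (hih false)).of_eq rfl (by simp; omega)
    · exact (Runs.loop_true h (hstep true) (hih true)).of_eq rfl (by simp; omega)

/-- `move a b t`: put the contents of `a` on top of `b` in order (via the empty scratch
register `t`), emptying `a`. [folklore] -/
def move (a b t : ι) : Com ι := pour a t ;; pour t b

/-- Effect of `move`, in `6|a| + 2` steps. [folklore] -/
theorem runs_move {a b t : ι} (hab : a ≠ b) (hat : a ≠ t) (hbt : b ≠ t) (R : Regs ι) (ht : R t = []) :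
    Runs (move a b t) R (Function.update (Function.update R a []) b (R a ++ R b)) (6 * (R a).length + 2) := by
  have h₁ := runs_pour hat R
  have h₂ := runs_pour hbt.symm (Function.update (Function.update R a []) t ((R a).reverse ++ R t))
  refine (h₁.seq h₂).of_eq ?_ ?_
  · ext i : 1
    simp only [Function.update_apply]
    split_ifs <;> simp_all
  · simp [ht]; omega

/-- `copy a b t u`: put a copy of `a` on top of `b` in order, keeping `a` (via the empty scratch
registers `t`, `u`). [folklore] -/
def copy (a b t u : ι) : Com ι :=
  loop a (push t true ;; push u true) (push t false ;; push u false) ;; pour t a ;; pour u b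

/-- The splitting loop of `copy`. [folklore] -/
theorem runs_copy_loop {a t u : ι} (hat : a ≠ t) (hau : a ≠ u) (htu : t ≠ u) (w : List Bool)
    (R : Regs ι) (ha : R a = w) :
    Runs (loop a (push t true ;; push u true) (push t false ;; push u false)) R
      (Function.update (Function.update (Function.update R a []) t (w.reverse ++ R t)) u
        (w.reverse ++ R u)) (4 * w.length + 1) := by
  induction w generalizing R with
  | nil =>
    refine (Runs.loop_nil _ _ ha).of_eq ?_ le_rfl
    ext i : 1
    simp only [Function.update_apply, List.reverse_nil, List.nil_append]
    split_ifs <;> simp_all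
  | cons c w ih =>
    have hbody : ∀ c : Bool, Runs (push t c ;; push u c) (Function.update R a w)
        (Function.update (Function.update (Function.update R a w) t (c :: R t)) u (c :: R u)) (1 + 1) := by
      intro c
      refine ((Runs.push t c _).seq (Runs.push u c _)).of_eq ?_ le_rfl
      simp [Function.update_of_ne hat.symm, Function.update_of_ne hau.symm, Function.update_of_ne htu.symm]
    have hih : ∀ c : Bool, Runs (loop a (push t true ;; push u true) (push t false ;; push u false))
        (Function.update (Function.update (Function.update R a w) t (c :: R t)) u (c :: R u))
        (Function.update (Function.update (Function.update R a []) t ((c :: w).reverse ++ R t)) u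
          ((c :: w).reverse ++ R u)) (4 * w.length + 1) := by
      intro c
      refine (ih _ (by simp [Function.update_of_ne hau, Function.update_of_ne hat])).of_eq ?_ le_rfl
      ext i : 1
      simp only [Function.update_apply]
      split_ifs <;> simp_all
    cases c
    · exact (Runs.loop_false ha (hbody false) (hih false)).of_eq rfl (by simp; omega)
    · exact (Runs.loop_true ha (hbody true) (hih true)).of_eq rfl (by simp; omega)

/-- Effect of `copy`, in `10|a| + 3` steps. [folklore] -/
theorem runs_copy {a b t u : ι} (hab : a ≠ b) (hat : a ≠ t) (hau : a ≠ u) (hbt : b ≠ t)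
    (hbu : b ≠ u) (htu : t ≠ u) (R : Regs ι) (ht : R t = []) (hu : R u = []) :
    Runs (copy a b t u) R (Function.update R b (R a ++ R b)) (10 * (R a).length + 3) := by
  have h₁ := runs_copy_loop hat hau htu (R a) R rfl
  rw [ht, hu, List.append_nil] at h₁
  set R₁ := Function.update (Function.update (Function.update R a []) t (R a).reverse) u (R a).reverse
  have h₂ := runs_pour hat.symm R₁
  set R₂ := Function.update (Function.update R₁ t []) a ((R₁ t).reverse ++ R₁ a)
  have h₃ := runs_pour hbu.symm R₂
  refine (h₁.seq (h₂.seq h₃)).of_eq ?_ ?_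
  · ext i : 1
    simp only [R₂, R₁, Function.update_apply]
    split_ifs <;> simp_all
  · simp [R₂, R₁, Function.update_apply, htu.symm, hau, hat, hau.symm]
    omega

end Generic

end Com

/-! ### The arithmetic register bank -/

/-- The eight registers of the arithmetic bank: operands/results `x y z`, scratch `s t u`,
flags `f g`. [folklore] -/
inductive AReg where
  | x | y | z | s | t | u | f | g
  deriving DecidableEq, Fintype, Repr

namespace AReg

/-- A register file of the arithmetic bank given register by register. [folklore] -/
def file (x y z s t u f g : List Bool) : Regs AReg
  | .x => x | .y => y | .z => z | .s => s | .t => t | .u => u | .f => f | .g => g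

section FileLemmas

variable (x y z s t u f g v : List Bool)

/-- Reading `x`. [folklore] -/ @[simp] theorem file_x : file x y z s t u f g .x = x := rfl
/-- Reading `y`. [folklore] -/ @[simp] theorem file_y : file x y z s t u f g .y = y := rfl
/-- Reading `z`. [folklore] -/ @[simp] theorem file_z : file x y z s t u f g .z = z := rfl
/-- Reading `s`. [folklore] -/ @[simp] theorem file_s : file x y z s t u f g .s = s := rfl
/-- Reading `t`. [folklore] -/ @[simp] theorem file_t : file x y z s t u f g .t = t := rfl
/-- Reading `u`. [folklore] -/ @[simp] theorem file_u : file x y z s t u f g .u = u := rfl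
/-- Reading `f`. [folklore] -/ @[simp] theorem file_f : file x y z s t u f g .f = f := rfl
/-- Reading `g`. [folklore] -/ @[simp] theorem file_g : file x y z s t u f g .g = g := rfl
/-- Writing `x`. [folklore] -/
@[simp] theorem update_file_x : Function.update (file x y z s t u f g) .x v = file v y z s t u f g := by
  funext r; cases r <;> rfl
/-- Writing `y`. [folklore] -/
@[simp] theorem update_file_y : Function.update (file x y z s t u f g) .y v = file x v z s t u f g := by
  funext r; cases r <;> rfl
/-- Writing `z`. [folklore] -/
@[simp] theorem update_file_z : Function.update (file x y z s t u f g) .z v = file x y v s t u f g := by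
  funext r; cases r <;> rfl
/-- Writing `s`. [folklore] -/
@[simp] theorem update_file_s : Function.update (file x y z s t u f g) .s v = file x y z v t u f g := by
  funext r; cases r <;> rfl
/-- Writing `t`. [folklore] -/
@[simp] theorem update_file_t : Function.update (file x y z s t u f g) .t v = file x y z s v u f g := by
  funext r; cases r <;> rfl
/-- Writing `u`. [folklore] -/
@[simp] theorem update_file_u : Function.update (file x y z s t u f g) .u v = file x y z s t v f g := by
  funext r; cases r <;> rfl
/-- Writing `f`. [folklore] -/
@[simp] theorem update_file_f : Function.update (file x y z s t u f g) .f v = file x y z s t u v g := by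
  funext r; cases r <;> rfl
/-- Writing `g`. [folklore] -/
@[simp] theorem update_file_g : Function.update (file x y z s t u f g) .g v = file x y z s t u f v := by
  funext r; cases r <;> rfl

/-- Every register file of the bank is a `file`. [folklore] -/
theorem eq_file (R : Regs AReg) : R = file (R .x) (R .y) (R .z) (R .s) (R .t) (R .u) (R .f) (R .g) := by
  funext r; cases r <;> rfl

end FileLemmas

end AReg

/-- A Boolean flag as register contents: `[true]` or `[]`. [folklore] -/
def flag (c : Bool) : List Bool := bif c then [true] else []

/-- The set flag. [folklore] -/ @[simp] theorem flag_true : flag true = [true] := rfl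
/-- The cleared flag. [folklore] -/ @[simp] theorem flag_false : flag false = [] := rfl

namespace Com

open AReg

/-! ### Normalisation -/

/-- `setTrue r`: replace the top bit of `r` by `true`, or push `true` if `r` is empty (so a flag
becomes set). [folklore] -/
def setTrue (r : AReg) : Com AReg := pop r (push r true) (push r true) (push r true)

/-- `setTrue .f` sets the flag `f`. [folklore] -/
theorem runs_setTrue_f (x y z s t u g : List Bool) (c : Bool) :
    Runs (setTrue .f) (file x y z s t u (flag c) g) (file x y z s t u (flag true) g) 3 := by
  cases c
  · exact (Runs.pop_nil _ _ (by rfl) (Runs.push _ _ _)).of_eq (by simp) le_rfl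
  · have h : Runs (Com.push AReg.f true) (file x y z s t u [] g) (file x y z s t u [true] g) 1 :=
      Runs.push' (by simp)
    exact Runs.pop_true' _ _ (R := file x y z s t u (flag true) g) (w := []) rfl (by simp) h

/-- Model of the normalising loop: read the bits most significant first, drop zeros until the
first one (`seen`), then copy. [folklore] -/
def nz : List Bool → Bool → List Bool → List Bool
  | [], _, acc => acc
  | b :: r, seen, acc =>
    if b then nz r true (true :: acc) else if seen then nz r true (false :: acc) else nz r false acc

/-- The flag after the normalising loop. [folklore] -/
def nzF : List Bool → Bool → Bool
  | [], seen => seen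
  | b :: r, seen => nzF r (seen || b)

/-- Once a one has been seen the loop just copies (reversing onto the accumulator). [folklore] -/
theorem nz_true (r acc : List Bool) : nz r true acc = r.reverse ++ acc := by
  induction r generalizing acc with
  | nil => rfl
  | cons b r ih => cases b <;> simp [nz, ih]

/-- Leading zeros are dropped. [folklore] -/
theorem nz_replicate_false_append (n : ℕ) (r acc : List Bool) :
    nz (List.replicate n false ++ r) false acc = nz r false acc := by
  induction n with
  | zero => rfl
  | succ n ih => simpa [List.replicate_succ, nz] using ih

/-- **The normalising loop computes `norm`.** [folklore] -/
theorem nz_reverse (w : List Bool) : nz w.reverse false [] = norm w := by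
  obtain ⟨n, hn⟩ := exists_eq_norm_append w
  conv_lhs => rw [hn]
  rw [List.reverse_append, List.reverse_replicate, nz_replicate_false_append]
  rcases norm_eq_nil_or_getLast w with h | ⟨v, hv⟩
  · rw [h]; rfl
  · rw [hv, List.reverse_append]
    simp [nz, nz_true]

/-- The normalising loop. [folklore] -/
def normLoop : Com AReg :=
  loop .s (push .x true ;; setTrue .f)
    (pop .f (push .f true ;; push .x false) (push .f true ;; push .x false) skip)

/-- `normalize`: `x := norm x` (scratch `s`, flag `f`, both empty before and after). [folklore] -/
def normalize : Com AReg := pour .x .s ;; normLoop ;; clear .f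

/-- Simulation of the normalising loop. [folklore] -/
theorem runs_normLoop (r : List Bool) (seen : Bool) (acc y z t u g : List Bool) :
    Runs normLoop (file acc y z r t u (flag seen) g)
      (file (nz r seen acc) y z [] t u (flag (nzF r seen)) g) (6 * r.length + 1) := by
  induction r generalizing seen acc with
  | nil => exact (Runs.loop_nil _ _ (by rfl)).of_eq (by simp [nz, nzF]) (by simp)
  | cons b r ih =>
    cases b
    · -- a zero: dropped or copied according to the flag
      cases seen
      · have hbody : Runs (pop .f (push .f true ;; push .x false) (push .f true ;; push .x false) skip)
            (file acc y z r t u (flag false) g) (file acc y z r t u (flag false) g) (0 + 2) :=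
          Runs.pop_nil _ _ (by rfl) (Runs.skip _)
        refine (Runs.loop_false' (w := r) ?_ ?_ hbody (ih false acc)).of_eq ?_ ?_
        · rfl
        · simp
        · simp [nz, nzF]
        · simp; omega
      · have h2a : Runs (push .f true) (file acc y z r t u [] g) (file acc y z r t u [true] g) 1 :=
          Runs.push' (by simp)
        have h2b : Runs (push .x false) (file acc y z r t u [true] g)
            (file (false :: acc) y z r t u [true] g) 1 := Runs.push' (by simp)
        have h2 := h2a.seq h2b
        have hbody : Runs (pop .f (push .f true ;; push .x false) (push .f true ;; push .x false) skip)
            (file acc y z r t u (flag true) g) (file (false :: acc) y z r t u (flag true) g) ((1 + 1) + 2) :=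
          Runs.pop_true' _ _ (R := file acc y z r t u (flag true) g) (w := []) rfl (by simp) h2
        refine (Runs.loop_false' (w := r) ?_ ?_ hbody (ih true (false :: acc))).of_eq ?_ ?_
        · rfl
        · simp
        · simp [nz, nzF]
        · simp; omega
    · -- a one: copied, flag set
      have h1 : Runs (push .x true) (file acc y z r t u (flag seen) g)
          (file (true :: acc) y z r t u (flag seen) g) 1 := Runs.push' (by simp)
      have hbody : Runs (push .x true ;; setTrue .f) (file acc y z r t u (flag seen) g)
          (file (true :: acc) y z r t u (flag true) g) (1 + 3) :=
        h1.seq (runs_setTrue_f _ _ _ _ _ _ _ seen)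
      refine (Runs.loop_true' (w := r) ?_ ?_ hbody (ih true (true :: acc))).of_eq ?_ ?_
      · rfl
      · simp
      · simp [nz, nzF]
      · simp; omega

/-- **`normalize` computes the normal form**: `x := norm x`, in `9|x| + 5` steps. [folklore] -/
theorem runs_normalize (w y z t u g : List Bool) :
    Runs normalize (file w y z [] t u [] g) (file (norm w) y z [] t u [] g) (9 * w.length + 5) := by
  have h₁ : Runs (pour .x .s) (file w y z [] t u [] g) (file [] y z w.reverse t u [] g) (3 * w.length + 1) :=
    (runs_pour (a := AReg.x) (b := AReg.s) (by decide) _).of_eq (by simp) (by simp)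
  have h₂ := runs_normLoop w.reverse false [] y z t u g
  rw [flag_false, nz_reverse] at h₂
  have h₃ : Runs (clear .f) (file (norm w) y z [] t u (flag (nzF w.reverse false)) g)
      (file (norm w) y z [] t u [] g) (2 * 1 + 1) :=
    (runs_clear AReg.f _).of_eq (by simp) (by cases nzF w.reverse false <;> simp)
  exact (h₁.seq (h₂.seq h₃)).of_eq rfl (by simp; omega)

/-! ### Addition -/

/-- The full-adder identity for Mathlib's sum bit `Bool.xor3` and carry bit `Bool.carry`.
[Knuth 1998, §4.3.1] [folklore] -/
theorem xor3_add_carry (a b c : Bool) :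
    (Bool.xor3 a b c).toNat + 2 * (Bool.carry a b c).toNat = a.toNat + b.toNat + c.toNat := by
  cases a <;> cases b <;> cases c <;> rfl

/-- A leaf of the addition loop: emit the sum bit, save the bit of `y`, set the carry.
[Knuth 1998, §4.3.1, Algorithm A, step A2] [folklore] -/
def addLeaf (a b c : Bool) : Com AReg :=
  push .s (Bool.xor3 a b c) ;; push .t b ;; bif Bool.carry a b c then push .f true else skip

/-- A leaf of the addition loop when `y` is exhausted (its bit counts as `0`, nothing is saved).
[Knuth 1998, §4.3.1, Algorithm A] [folklore] -/
def addLeafN (a c : Bool) : Com AReg :=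
  push .s (Bool.xor3 a false c) ;; bif Bool.carry a false c then push .f true else skip

/-- Body of the first addition loop for a bit `a` of `x`: read a bit of `y` and the carry.
[Knuth 1998, §4.3.1, Algorithm A] [folklore] -/
def addBody (a : Bool) : Com AReg :=
  pop .y (pop .f (addLeaf a true true) (addLeaf a true true) (addLeaf a true false))
    (pop .f (addLeaf a false true) (addLeaf a false true) (addLeaf a false false))
    (pop .f (addLeafN a true) (addLeafN a true) (addLeafN a false))

/-- First addition loop: over the bits of `x`. [Knuth 1998, §4.3.1, Algorithm A] [folklore] -/
def addLoop1 : Com AReg := loop .x (addBody true) (addBody false)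

/-- Body of the second addition loop (bits of `y` beyond `x`). [Knuth 1998, §4.3.1] [folklore] -/
def addBody2 (b : Bool) : Com AReg :=
  pop .f (addLeaf false b true) (addLeaf false b true) (addLeaf false b false)

/-- Second addition loop: over the remaining bits of `y`. [Knuth 1998, §4.3.1] [folklore] -/
def addLoop2 : Com AReg := loop .y (addBody2 true) (addBody2 false)

/-- **Addition** `x := x + y` (`y` preserved; scratch `s t`, flag `f`, empty before and after).
[Knuth 1998, §4.3.1, Algorithm A] [folklore] -/
def add : Com AReg :=
  addLoop1 ;; addLoop2 ;; pop .f (push .s true) (push .s true) skip ;; pour .s .x ;; pour .t .y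

/-- Model of the first loop: (sum bits so far, reversed; saved bits of `y`, reversed; carry).
[folklore] -/
def adL1 : List Bool → List Bool → Bool → List Bool → List Bool → List Bool × List Bool × Bool
  | [], _, c, sa, ta => (sa, ta, c)
  | a :: xs, [], c, sa, ta => adL1 xs [] (Bool.carry a false c) (Bool.xor3 a false c :: sa) ta
  | a :: xs, b :: ys, c, sa, ta => adL1 xs ys (Bool.carry a b c) (Bool.xor3 a b c :: sa) (b :: ta)

/-- Model of the second loop. [folklore] -/
def adL2 : List Bool → Bool → List Bool → List Bool → List Bool × List Bool × Bool
  | [], c, sa, ta => (sa, ta, c)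
  | b :: ys, c, sa, ta => adL2 ys (Bool.carry false b c) (Bool.xor3 false b c :: sa) (b :: ta)

/-- **The result of `add`** (a bit string, least significant bit first). [folklore] -/
def addRes (xs ys : List Bool) : List Bool :=
  (bif (adL2 (ys.drop xs.length) (adL1 xs ys false [] []).2.2 (adL1 xs ys false [] []).1
        (adL1 xs ys false [] []).2.1).2.2
    then true :: (adL2 (ys.drop xs.length) (adL1 xs ys false [] []).2.2 (adL1 xs ys false [] []).1
        (adL1 xs ys false [] []).2.1).1
    else (adL2 (ys.drop xs.length) (adL1 xs ys false [] []).2.2 (adL1 xs ys false [] []).1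
        (adL1 xs ys false [] []).2.1).1).reverse

/-- Simulation of an addition leaf. [folklore] -/
theorem runs_addLeaf (a b c : Bool) (xs ys z sa ta u g : List Bool) :
    Runs (addLeaf a b c) (file xs ys z sa ta u [] g)
      (file xs ys z (Bool.xor3 a b c :: sa) (b :: ta) u (flag (Bool.carry a b c)) g) 3 := by
  have h1 : Runs (push .s (Bool.xor3 a b c)) (file xs ys z sa ta u [] g)
      (file xs ys z (Bool.xor3 a b c :: sa) ta u [] g) 1 := Runs.push' (by simp)
  have h2 : Runs (push .t b) (file xs ys z (Bool.xor3 a b c :: sa) ta u [] g)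
      (file xs ys z (Bool.xor3 a b c :: sa) (b :: ta) u [] g) 1 := Runs.push' (by simp)
  unfold addLeaf
  cases Bool.carry a b c
  · exact (h1.seq (h2.seq (Runs.skip _))).of_eq (by simp) (by norm_num)
  · have h3 : Runs (push .f true) (file xs ys z (Bool.xor3 a b c :: sa) (b :: ta) u [] g)
        (file xs ys z (Bool.xor3 a b c :: sa) (b :: ta) u [true] g) 1 := Runs.push' (by simp)
    exact (h1.seq (h2.seq h3)).of_eq (by simp) (by norm_num)

/-- Simulation of an addition leaf with `y` exhausted. [folklore] -/
theorem runs_addLeafN (a c : Bool) (xs ys z sa ta u g : List Bool) :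
    Runs (addLeafN a c) (file xs ys z sa ta u [] g)
      (file xs ys z (Bool.xor3 a false c :: sa) ta u (flag (Bool.carry a false c)) g) 3 := by
  have h1 : Runs (push .s (Bool.xor3 a false c)) (file xs ys z sa ta u [] g)
      (file xs ys z (Bool.xor3 a false c :: sa) ta u [] g) 1 := Runs.push' (by simp)
  unfold addLeafN
  cases Bool.carry a false c
  · exact (h1.seq (Runs.skip _)).of_eq (by simp) (by norm_num)
  · have h3 : Runs (push .f true) (file xs ys z (Bool.xor3 a false c :: sa) ta u [] g)
        (file xs ys z (Bool.xor3 a false c :: sa) ta u [true] g) 1 := Runs.push' (by simp)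
    exact (h1.seq h3).of_eq (by simp) (by norm_num)

/-- Simulation of the body of the first loop, `y` nonempty. [folklore] -/
theorem runs_addBody_cons (a b c : Bool) (xs ys z sa ta u g : List Bool) :
    Runs (addBody a) (file xs (b :: ys) z sa ta u (flag c) g)
      (file xs ys z (Bool.xor3 a b c :: sa) (b :: ta) u (flag (Bool.carry a b c)) g) 7 := by
  unfold addBody
  cases b
  · cases c
    · exact Runs.pop_false' _ _ (R := file xs (false :: ys) z sa ta u (flag false) g) rfl (by simp)
        (Runs.pop_nil _ _ (R := file xs ys z sa ta u [] g) rfl (runs_addLeaf a false false _ _ _ _ _ _ _))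
    · exact Runs.pop_false' _ _ (R := file xs (false :: ys) z sa ta u (flag true) g) rfl (by simp)
        (Runs.pop_true' _ _ (R := file xs ys z sa ta u [true] g) (w := []) rfl (by simp)
          (runs_addLeaf a false true _ _ _ _ _ _ _))
  · cases c
    · exact Runs.pop_true' _ _ (R := file xs (true :: ys) z sa ta u (flag false) g) rfl (by simp)
        (Runs.pop_nil _ _ (R := file xs ys z sa ta u [] g) rfl (runs_addLeaf a true false _ _ _ _ _ _ _))
    · exact Runs.pop_true' _ _ (R := file xs (true :: ys) z sa ta u (flag true) g) rfl (by simp)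
        (Runs.pop_true' _ _ (R := file xs ys z sa ta u [true] g) (w := []) rfl (by simp)
          (runs_addLeaf a true true _ _ _ _ _ _ _))

/-- Simulation of the body of the first loop, `y` exhausted. [folklore] -/
theorem runs_addBody_nil (a c : Bool) (xs z sa ta u g : List Bool) :
    Runs (addBody a) (file xs [] z sa ta u (flag c) g)
      (file xs [] z (Bool.xor3 a false c :: sa) ta u (flag (Bool.carry a false c)) g) 7 := by
  unfold addBody
  cases c
  · exact Runs.pop_nil _ _ (R := file xs [] z sa ta u (flag false) g) rfl
      (Runs.pop_nil _ _ (R := file xs [] z sa ta u [] g) rfl (runs_addLeafN a false _ _ _ _ _ _ _))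
  · exact Runs.pop_nil _ _ (R := file xs [] z sa ta u (flag true) g) rfl
      (Runs.pop_true' _ _ (R := file xs [] z sa ta u [true] g) (w := []) rfl (by simp)
        (runs_addLeafN a true _ _ _ _ _ _ _))

/-- Simulation of the first addition loop. [folklore] -/
theorem runs_addLoop1 (xs ys : List Bool) (c : Bool) (sa ta z u g : List Bool) :
    Runs addLoop1 (file xs ys z sa ta u (flag c) g)
      (file [] (ys.drop xs.length) z (adL1 xs ys c sa ta).1 (adL1 xs ys c sa ta).2.1 u
        (flag (adL1 xs ys c sa ta).2.2) g) (9 * xs.length + 1) := by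
  induction xs generalizing ys c sa ta with
  | nil => exact (Runs.loop_nil _ _ (by rfl)).of_eq (by simp [adL1]) (by simp)
  | cons a xs ih =>
    cases ys with
    | nil =>
      have hbody := runs_addBody_nil a c xs z sa ta u g
      have hrest := ih [] (Bool.carry a false c) (Bool.xor3 a false c :: sa) ta
      cases a
      · refine (Runs.loop_false' (w := xs) ?_ ?_ hbody hrest).of_eq ?_ ?_
        · rfl
        · simp
        · simp [adL1]
        · simp; omega
      · refine (Runs.loop_true' (w := xs) ?_ ?_ hbody hrest).of_eq ?_ ?_
        · rfl
        · simp
        · simp [adL1]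
        · simp; omega
    | cons b ys =>
      have hbody := runs_addBody_cons a b c xs ys z sa ta u g
      have hrest := ih ys (Bool.carry a b c) (Bool.xor3 a b c :: sa) (b :: ta)
      cases a
      · refine (Runs.loop_false' (w := xs) ?_ ?_ hbody hrest).of_eq ?_ ?_
        · rfl
        · simp
        · simp [adL1]
        · simp; omega
      · refine (Runs.loop_true' (w := xs) ?_ ?_ hbody hrest).of_eq ?_ ?_
        · rfl
        · simp
        · simp [adL1]
        · simp; omega

/-- Simulation of the body of the second loop. [folklore] -/
theorem runs_addBody2 (b c : Bool) (ys z sa ta u g : List Bool) :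
    Runs (addBody2 b) (file [] ys z sa ta u (flag c) g)
      (file [] ys z (Bool.xor3 false b c :: sa) (b :: ta) u (flag (Bool.carry false b c)) g) 5 := by
  unfold addBody2
  cases c
  · exact Runs.pop_nil _ _ (R := file [] ys z sa ta u (flag false) g) rfl
      (runs_addLeaf false b false _ _ _ _ _ _ _)
  · exact Runs.pop_true' _ _ (R := file [] ys z sa ta u (flag true) g) (w := []) rfl (by simp)
      (runs_addLeaf false b true _ _ _ _ _ _ _)

/-- Simulation of the second addition loop. [folklore] -/
theorem runs_addLoop2 (ys : List Bool) (c : Bool) (sa ta z u g : List Bool) :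
    Runs addLoop2 (file [] ys z sa ta u (flag c) g)
      (file [] [] z (adL2 ys c sa ta).1 (adL2 ys c sa ta).2.1 u (flag (adL2 ys c sa ta).2.2) g)
      (7 * ys.length + 1) := by
  induction ys generalizing c sa ta with
  | nil => exact (Runs.loop_nil _ _ (by rfl)).of_eq (by simp [adL2]) (by simp)
  | cons b ys ih =>
    have hbody := runs_addBody2 b c ys z sa ta u g
    have hrest := ih (Bool.carry false b c) (Bool.xor3 false b c :: sa) (b :: ta)
    cases b
    · refine (Runs.loop_false' (w := ys) ?_ ?_ hbody hrest).of_eq ?_ ?_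
      · rfl
      · simp
      · simp [adL2]
      · simp; omega
    · refine (Runs.loop_true' (w := ys) ?_ ?_ hbody hrest).of_eq ?_ ?_
      · rfl
      · simp
      · simp [adL2]
      · simp; omega

/-- The first loop saves the consumed bits of `y`, reversed. [folklore] -/
theorem adL1_ta (xs ys : List Bool) (c : Bool) (sa ta : List Bool) :
    (adL1 xs ys c sa ta).2.1 = (ys.take xs.length).reverse ++ ta := by
  induction xs generalizing ys c sa ta with
  | nil => simp [adL1]
  | cons a xs ih => cases ys <;> simp [adL1, ih]

/-- The first loop emits one bit per bit of `x`. [folklore] -/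
theorem adL1_length (xs ys : List Bool) (c : Bool) (sa ta : List Bool) :
    (adL1 xs ys c sa ta).1.length = sa.length + xs.length := by
  induction xs generalizing ys c sa ta with
  | nil => simp [adL1]
  | cons a xs ih => cases ys <;> simp [adL1, ih] <;> omega

/-- **Value invariant of the first loop** (ripple-carry addition of `x` and the low bits of
`y`). [Knuth 1998, §4.3.1, Algorithm A (correctness)] [folklore] -/
theorem adL1_val (xs ys : List Bool) (c : Bool) (sa ta : List Bool) :
    bitsToNat (adL1 xs ys c sa ta).1.reverse + 2 ^ (adL1 xs ys c sa ta).1.length * ((adL1 xs ys c sa ta).2.2).toNat =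
      bitsToNat sa.reverse + 2 ^ sa.length * (bitsToNat xs + bitsToNat (ys.take xs.length) + c.toNat) := by
  induction xs generalizing ys c sa ta with
  | nil => simp [adL1]
  | cons a xs ih =>
    have key : ∀ b, 2 ^ sa.length * (Bool.xor3 a b c).toNat + 2 ^ sa.length * 2 * (Bool.carry a b c).toNat =
        2 ^ sa.length * a.toNat + 2 ^ sa.length * b.toNat + 2 ^ sa.length * c.toNat := fun b => by
      have := congrArg (2 ^ sa.length * ·) (xor3_add_carry a b c)
      simp only [mul_add] at this
      simpa [Nat.mul_assoc, Nat.mul_left_comm] using this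
    cases ys with
    | nil =>
      rw [adL1, ih]
      simp only [List.length_cons, List.reverse_cons, bitsToNat_append, List.length_reverse,
        List.take_nil, bitsToNat_nil, bitsToNat_cons, pow_succ, mul_add,
        mul_zero, add_zero]
      have := key false
      simp only [Bool.toNat_false, mul_zero, add_zero] at this
      simp only [Nat.mul_assoc, Nat.mul_left_comm (2 ^ sa.length) 2] at this ⊢
      omega
    | cons b ys =>
      rw [adL1, ih]
      simp only [List.length_cons, List.reverse_cons, bitsToNat_append, List.length_reverse,
        List.take_succ_cons, bitsToNat_cons, pow_succ, mul_add,
        bitsToNat_nil, mul_zero, add_zero]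
      have := key b
      simp only [Nat.mul_assoc, Nat.mul_left_comm (2 ^ sa.length) 2] at this ⊢
      omega

/-- The second loop saves the bits of `y`, reversed. [folklore] -/
theorem adL2_ta (ys : List Bool) (c : Bool) (sa ta : List Bool) :
    (adL2 ys c sa ta).2.1 = ys.reverse ++ ta := by
  induction ys generalizing c sa ta with
  | nil => simp [adL2]
  | cons b ys ih => simp [adL2, ih]

/-- The second loop emits one bit per bit. [folklore] -/
theorem adL2_length (ys : List Bool) (c : Bool) (sa ta : List Bool) :
    (adL2 ys c sa ta).1.length = sa.length + ys.length := by
  induction ys generalizing c sa ta with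
  | nil => simp [adL2]
  | cons b ys ih => simp [adL2, ih]; omega

/-- **Value invariant of the second loop.** [Knuth 1998, §4.3.1] [folklore] -/
theorem adL2_val (ys : List Bool) (c : Bool) (sa ta : List Bool) :
    bitsToNat (adL2 ys c sa ta).1.reverse + 2 ^ (adL2 ys c sa ta).1.length * ((adL2 ys c sa ta).2.2).toNat =
      bitsToNat sa.reverse + 2 ^ sa.length * (bitsToNat ys + c.toNat) := by
  induction ys generalizing c sa ta with
  | nil => simp [adL2]
  | cons b ys ih =>
    rw [adL2, ih]
    simp only [List.length_cons, List.reverse_cons, bitsToNat_append, List.length_reverse,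
      bitsToNat_cons, pow_succ, mul_add, bitsToNat_nil, mul_zero,
      add_zero]
    have := congrArg (2 ^ sa.length * ·) (xor3_add_carry false b c)
    simp only [mul_add, Bool.toNat_false, zero_add] at this
    simp only [Nat.mul_assoc, Nat.mul_left_comm (2 ^ sa.length) 2] at this ⊢
    omega

/-- Splitting the value of `y` at position `n`. [folklore] -/
theorem bitsToNat_take_add_drop (ys : List Bool) (n : ℕ) :
    bitsToNat (ys.take n) + 2 ^ n * bitsToNat (ys.drop n) = bitsToNat ys := by
  by_cases h : n ≤ ys.length
  · conv_rhs => rw [← List.take_append_drop n ys, bitsToNat_append]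
    rw [List.length_take, Nat.min_eq_left h]
  · rw [not_le] at h
    rw [List.drop_eq_nil_of_le h.le, List.take_of_length_le h.le]
    simp

/-- **`add` is correct**: the value of the result is the sum. [Knuth 1998, §4.3.1, Algorithm A]
[folklore] -/
theorem bitsToNat_addRes (xs ys : List Bool) : bitsToNat (addRes xs ys) = bitsToNat xs + bitsToNat ys := by
  have h1 := adL1_val xs ys false [] []
  have h1l := adL1_length xs ys false [] []
  have h2 := adL2_val (ys.drop xs.length) (adL1 xs ys false [] []).2.2 (adL1 xs ys false [] []).1
    (adL1 xs ys false [] []).2.1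
  have hsplit := bitsToNat_take_add_drop ys xs.length
  unfold addRes
  generalize adL2 (ys.drop xs.length) (adL1 xs ys false [] []).2.2 (adL1 xs ys false [] []).1
    (adL1 xs ys false [] []).2.1 = r₂ at h2 ⊢
  generalize adL1 xs ys false [] [] = r₁ at h1 h1l h2
  obtain ⟨s₁, t₁, c₁⟩ := r₁
  obtain ⟨s₂, t₂, c₂⟩ := r₂
  simp only [List.reverse_nil, bitsToNat_nil, List.length_nil, pow_zero, one_mul, zero_add,
    Bool.toNat_false, add_zero, mul_add] at h1 h1l h2
  rw [h1l] at h1 h2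
  cases c₂
  · simp only [cond_false, Bool.toNat_false, mul_zero, add_zero] at h2 ⊢
    omega
  · simp only [cond_true, List.reverse_cons, bitsToNat_append, List.length_reverse, bitsToNat_cons,
      Bool.toNat_true, bitsToNat_nil, mul_zero, add_zero, mul_one] at h2 ⊢
    omega

/-- The result of `add` has at most `|x| + |y| + 1` bits. [folklore] -/
theorem length_addRes_le (xs ys : List Bool) : (addRes xs ys).length ≤ xs.length + ys.length + 1 := by
  have h1l := adL1_length xs ys false [] []
  have h2l := adL2_length (ys.drop xs.length) (adL1 xs ys false [] []).2.2 (adL1 xs ys false [] []).1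
    (adL1 xs ys false [] []).2.1
  unfold addRes
  generalize adL2 (ys.drop xs.length) (adL1 xs ys false [] []).2.2 (adL1 xs ys false [] []).1
    (adL1 xs ys false [] []).2.1 = r₂ at h2l ⊢
  generalize adL1 xs ys false [] [] = r₁ at h1l h2l
  obtain ⟨s₂, t₂, c₂⟩ := r₂
  simp only [List.length_nil, zero_add, List.length_drop] at h1l h2l
  cases c₂ <;> simp <;> omega

/-- The result of `add` has at most `max |x| |y| + 1` bits. [folklore] -/
theorem length_addRes_le_max (xs ys : List Bool) :
    (addRes xs ys).length ≤ max xs.length ys.length + 1 := by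
  have h1l := adL1_length xs ys false [] []
  have h2l := adL2_length (ys.drop xs.length) (adL1 xs ys false [] []).2.2 (adL1 xs ys false [] []).1
    (adL1 xs ys false [] []).2.1
  unfold addRes
  generalize adL2 (ys.drop xs.length) (adL1 xs ys false [] []).2.2 (adL1 xs ys false [] []).1
    (adL1 xs ys false [] []).2.1 = r₂ at h2l ⊢
  generalize adL1 xs ys false [] [] = r₁ at h1l h2l
  obtain ⟨s₂, t₂, c₂⟩ := r₂
  simp only [List.length_nil, zero_add, List.length_drop] at h1l h2l
  cases c₂ <;> simp <;> omega

/-- **Simulation of `add`**: `x := x + y`, `y` preserved, scratch clean, in `13(|x| + |y|) + 12`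
steps. [Knuth 1998, §4.3.1, Algorithm A] [folklore] -/
theorem runs_add (xs ys z u g : List Bool) :
    Runs add (file xs ys z [] [] u [] g) (file (addRes xs ys) ys z [] [] u [] g)
      (13 * (xs.length + ys.length) + 12) := by
  have h1 := runs_addLoop1 xs ys false [] [] z u g
  rw [flag_false] at h1
  set r₁ := adL1 xs ys false [] [] with hr₁
  have h2 := runs_addLoop2 (ys.drop xs.length) r₁.2.2 r₁.1 r₁.2.1 z u g
  set r₂ := adL2 (ys.drop xs.length) r₁.2.2 r₁.1 r₁.2.1 with hr₂
  set fin := (bif r₂.2.2 then true :: r₂.1 else r₂.1) with hfin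
  have h3 : Runs (pop .f (push .s true) (push .s true) skip) (file [] [] z r₂.1 r₂.2.1 u (flag r₂.2.2) g)
      (file [] [] z fin r₂.2.1 u [] g) 3 := by
    cases hc : r₂.2.2
    · exact (Runs.pop_nil _ _ (R := file [] [] z r₂.1 r₂.2.1 u (flag false) g) rfl (Runs.skip _)).of_eq
        (by simp [hfin, hc]) (by norm_num)
    · have hp : Runs (push .s true) (file [] [] z r₂.1 r₂.2.1 u [] g) (file [] [] z fin r₂.2.1 u [] g) 1 :=
        Runs.push' (by simp [hfin, hc])
      exact Runs.pop_true' _ _ (R := file [] [] z r₂.1 r₂.2.1 u (flag true) g) (w := []) rfl (by simp) hp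
  have h4 : Runs (pour .s .x) (file [] [] z fin r₂.2.1 u [] g) (file fin.reverse [] z [] r₂.2.1 u [] g)
      (3 * fin.length + 1) :=
    (runs_pour (a := AReg.s) (b := AReg.x) (by decide) _).of_eq (by simp) (by simp)
  have h5 : Runs (pour .t .y) (file fin.reverse [] z [] r₂.2.1 u [] g)
      (file fin.reverse r₂.2.1.reverse z [] [] u [] g) (3 * r₂.2.1.length + 1) :=
    (runs_pour (a := AReg.t) (b := AReg.y) (by decide) _).of_eq (by simp) (by simp)
  have hta : r₂.2.1 = ys.reverse := by
    rw [hr₂, adL2_ta, hr₁, adL1_ta, List.append_nil, ← List.reverse_append, List.take_append_drop]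
  have hlen : fin.length ≤ xs.length + ys.length + 1 := by
    have := length_addRes_le xs ys
    have e : (addRes xs ys).length = fin.length := by
      show (bif r₂.2.2 then true :: r₂.1 else r₂.1).reverse.length = _
      rw [List.length_reverse]
    omega
  refine (h1.seq (h2.seq (h3.seq (h4.seq h5)))).of_eq ?_ ?_
  · rw [hta, List.reverse_reverse]; rfl
  · have : (ys.drop xs.length).length ≤ ys.length := by simp
    rw [hta, List.length_reverse]
    nlinarith [hlen, this]

/-! ### Subtraction and comparison -/

/-- Borrow bit of a full subtractor `a - b - c`. [Knuth 1998, §4.3.1, Algorithm S] [folklore] -/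
def bbor (a b c : Bool) : Bool := (!a && (b || c)) || (b && c)

/-- The full-subtractor identity `a + 2·borrow = d + b + c`. [Knuth 1998, §4.3.1] [folklore] -/
theorem xor3_add_bbor (a b c : Bool) :
    (Bool.xor3 a b c).toNat + b.toNat + c.toNat = a.toNat + 2 * (bbor a b c).toNat := by
  cases a <;> cases b <;> cases c <;> rfl

/-- A leaf of the subtraction loop: emit the difference bit, save both input bits, set the
borrow. [Knuth 1998, §4.3.1, Algorithm S, step S2] [folklore] -/
def subLeaf (a b c : Bool) : Com AReg :=
  push .s (Bool.xor3 a b c) ;; push .t b ;; push .u a ;; bif bbor a b c then push .f true else skip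

/-- A leaf of the subtraction loop when `y` is exhausted. [Knuth 1998, §4.3.1] [folklore] -/
def subLeafN (a c : Bool) : Com AReg :=
  push .s (Bool.xor3 a false c) ;; push .u a ;; bif bbor a false c then push .f true else skip

/-- Body of the first subtraction loop for a bit `a` of `x`. [Knuth 1998, §4.3.1] [folklore] -/
def subBody (a : Bool) : Com AReg :=
  pop .y (pop .f (subLeaf a true true) (subLeaf a true true) (subLeaf a true false))
    (pop .f (subLeaf a false true) (subLeaf a false true) (subLeaf a false false))
    (pop .f (subLeafN a true) (subLeafN a true) (subLeafN a false))

/-- First subtraction loop: over the bits of `x`. [Knuth 1998, §4.3.1, Algorithm S] [folklore] -/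
def subLoop1 : Com AReg := loop .x (subBody true) (subBody false)

/-- Body of the second subtraction loop: a remaining bit of `y` is saved and, if set, forces the
borrow. [Knuth 1998, §4.3.1] [folklore] -/
def subBody2 (b : Bool) : Com AReg := push .t b ;; bif b then setTrue .f else skip

/-- Second subtraction loop: over the remaining bits of `y`. [Knuth 1998, §4.3.1] [folklore] -/
def subLoop2 : Com AReg := loop .y (subBody2 true) (subBody2 false)

/-- **Conditional subtraction with comparison**: if `x ≥ y` then `x := x - y` and `g := [true]`,
otherwise `x` is unchanged and `g` stays empty; `y` preserved (scratch `s t u`, flag `f`).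
[Knuth 1998, §4.3.1, Algorithm S (with the final borrow as the comparison)] [folklore] -/
def sub : Com AReg :=
  subLoop1 ;; subLoop2 ;;
    pop .f (pour .u .x ;; clear .s) (pour .u .x ;; clear .s) (pour .s .x ;; clear .u ;; push .g true) ;;
    pour .t .y

/-- Model of the first subtraction loop: (difference bits, saved `y`, saved `x` — all reversed —
and the borrow). [folklore] -/
def sbL1 : List Bool → List Bool → Bool → List Bool → List Bool → List Bool →
    List Bool × List Bool × List Bool × Bool
  | [], _, c, sa, ta, ua => (sa, ta, ua, c)
  | a :: xs, [], c, sa, ta, ua => sbL1 xs [] (bbor a false c) (Bool.xor3 a false c :: sa) ta (a :: ua)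
  | a :: xs, b :: ys, c, sa, ta, ua => sbL1 xs ys (bbor a b c) (Bool.xor3 a b c :: sa) (b :: ta) (a :: ua)

/-- Model of the second subtraction loop: (saved `y`, borrow). [folklore] -/
def sbL2 : List Bool → Bool → List Bool → List Bool × Bool
  | [], c, ta => (ta, c)
  | b :: ys, c, ta => sbL2 ys (c || b) (b :: ta)

/-- The final borrow of the subtraction of `y` from `x` (set iff `x < y`). [folklore] -/
def subBorrow (xs ys : List Bool) : Bool :=
  (sbL2 (ys.drop xs.length) (sbL1 xs ys false [] [] []).2.2.2 (sbL1 xs ys false [] [] []).2.1).2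

/-- The difference bits (meaningful when there is no borrow). [folklore] -/
def subRes (xs ys : List Bool) : List Bool := (sbL1 xs ys false [] [] []).1.reverse

/-- Simulation of a subtraction leaf. [folklore] -/
theorem runs_subLeaf (a b c : Bool) (xs ys z sa ta ua g : List Bool) :
    Runs (subLeaf a b c) (file xs ys z sa ta ua [] g)
      (file xs ys z (Bool.xor3 a b c :: sa) (b :: ta) (a :: ua) (flag (bbor a b c)) g) 4 := by
  have h1 : Runs (push .s (Bool.xor3 a b c)) (file xs ys z sa ta ua [] g)
      (file xs ys z (Bool.xor3 a b c :: sa) ta ua [] g) 1 := Runs.push' (by simp)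
  have h2 : Runs (push .t b) (file xs ys z (Bool.xor3 a b c :: sa) ta ua [] g)
      (file xs ys z (Bool.xor3 a b c :: sa) (b :: ta) ua [] g) 1 := Runs.push' (by simp)
  have h3 : Runs (push .u a) (file xs ys z (Bool.xor3 a b c :: sa) (b :: ta) ua [] g)
      (file xs ys z (Bool.xor3 a b c :: sa) (b :: ta) (a :: ua) [] g) 1 := Runs.push' (by simp)
  unfold subLeaf
  cases bbor a b c
  · exact (h1.seq (h2.seq (h3.seq (Runs.skip _)))).of_eq (by simp) (by norm_num)
  · have h4 : Runs (push .f true) (file xs ys z (Bool.xor3 a b c :: sa) (b :: ta) (a :: ua) [] g)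
        (file xs ys z (Bool.xor3 a b c :: sa) (b :: ta) (a :: ua) [true] g) 1 := Runs.push' (by simp)
    exact (h1.seq (h2.seq (h3.seq h4))).of_eq (by simp) (by norm_num)

/-- Simulation of a subtraction leaf with `y` exhausted. [folklore] -/
theorem runs_subLeafN (a c : Bool) (xs ys z sa ta ua g : List Bool) :
    Runs (subLeafN a c) (file xs ys z sa ta ua [] g)
      (file xs ys z (Bool.xor3 a false c :: sa) ta (a :: ua) (flag (bbor a false c)) g) 4 := by
  have h1 : Runs (push .s (Bool.xor3 a false c)) (file xs ys z sa ta ua [] g)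
      (file xs ys z (Bool.xor3 a false c :: sa) ta ua [] g) 1 := Runs.push' (by simp)
  have h3 : Runs (push .u a) (file xs ys z (Bool.xor3 a false c :: sa) ta ua [] g)
      (file xs ys z (Bool.xor3 a false c :: sa) ta (a :: ua) [] g) 1 := Runs.push' (by simp)
  unfold subLeafN
  cases bbor a false c
  · exact (h1.seq (h3.seq (Runs.skip _))).of_eq (by simp) (by norm_num)
  · have h4 : Runs (push .f true) (file xs ys z (Bool.xor3 a false c :: sa) ta (a :: ua) [] g)
        (file xs ys z (Bool.xor3 a false c :: sa) ta (a :: ua) [true] g) 1 := Runs.push' (by simp)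
    exact (h1.seq (h3.seq h4)).of_eq (by simp) (by norm_num)

/-- Simulation of the body of the first subtraction loop, `y` nonempty. [folklore] -/
theorem runs_subBody_cons (a b c : Bool) (xs ys z sa ta ua g : List Bool) :
    Runs (subBody a) (file xs (b :: ys) z sa ta ua (flag c) g)
      (file xs ys z (Bool.xor3 a b c :: sa) (b :: ta) (a :: ua) (flag (bbor a b c)) g) 8 := by
  unfold subBody
  cases b
  · cases c
    · exact Runs.pop_false' _ _ (R := file xs (false :: ys) z sa ta ua (flag false) g) rfl (by simp)
        (Runs.pop_nil _ _ (R := file xs ys z sa ta ua [] g) rfl (runs_subLeaf a false false _ _ _ _ _ _ _))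
    · exact Runs.pop_false' _ _ (R := file xs (false :: ys) z sa ta ua (flag true) g) rfl (by simp)
        (Runs.pop_true' _ _ (R := file xs ys z sa ta ua [true] g) (w := []) rfl (by simp)
          (runs_subLeaf a false true _ _ _ _ _ _ _))
  · cases c
    · exact Runs.pop_true' _ _ (R := file xs (true :: ys) z sa ta ua (flag false) g) rfl (by simp)
        (Runs.pop_nil _ _ (R := file xs ys z sa ta ua [] g) rfl (runs_subLeaf a true false _ _ _ _ _ _ _))
    · exact Runs.pop_true' _ _ (R := file xs (true :: ys) z sa ta ua (flag true) g) rfl (by simp)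
        (Runs.pop_true' _ _ (R := file xs ys z sa ta ua [true] g) (w := []) rfl (by simp)
          (runs_subLeaf a true true _ _ _ _ _ _ _))

/-- Simulation of the body of the first subtraction loop, `y` exhausted. [folklore] -/
theorem runs_subBody_nil (a c : Bool) (xs z sa ta ua g : List Bool) :
    Runs (subBody a) (file xs [] z sa ta ua (flag c) g)
      (file xs [] z (Bool.xor3 a false c :: sa) ta (a :: ua) (flag (bbor a false c)) g) 8 := by
  unfold subBody
  cases c
  · exact Runs.pop_nil _ _ (R := file xs [] z sa ta ua (flag false) g) rfl
      (Runs.pop_nil _ _ (R := file xs [] z sa ta ua [] g) rfl (runs_subLeafN a false _ _ _ _ _ _ _))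
  · exact Runs.pop_nil _ _ (R := file xs [] z sa ta ua (flag true) g) rfl
      (Runs.pop_true' _ _ (R := file xs [] z sa ta ua [true] g) (w := []) rfl (by simp)
        (runs_subLeafN a true _ _ _ _ _ _ _))

/-- Simulation of the first subtraction loop. [folklore] -/
theorem runs_subLoop1 (xs ys : List Bool) (c : Bool) (sa ta ua z g : List Bool) :
    Runs subLoop1 (file xs ys z sa ta ua (flag c) g)
      (file [] (ys.drop xs.length) z (sbL1 xs ys c sa ta ua).1 (sbL1 xs ys c sa ta ua).2.1
        (sbL1 xs ys c sa ta ua).2.2.1 (flag (sbL1 xs ys c sa ta ua).2.2.2) g) (10 * xs.length + 1) := by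
  induction xs generalizing ys c sa ta ua with
  | nil => exact (Runs.loop_nil _ _ (by rfl)).of_eq (by simp [sbL1]) (by simp)
  | cons a xs ih =>
    cases ys with
    | nil =>
      have hbody := runs_subBody_nil a c xs z sa ta ua g
      have hrest := ih [] (bbor a false c) (Bool.xor3 a false c :: sa) ta (a :: ua)
      cases a
      · refine (Runs.loop_false' (w := xs) ?_ ?_ hbody hrest).of_eq ?_ ?_
        · rfl
        · simp
        · simp [sbL1]
        · simp; omega
      · refine (Runs.loop_true' (w := xs) ?_ ?_ hbody hrest).of_eq ?_ ?_
        · rfl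
        · simp
        · simp [sbL1]
        · simp; omega
    | cons b ys =>
      have hbody := runs_subBody_cons a b c xs ys z sa ta ua g
      have hrest := ih ys (bbor a b c) (Bool.xor3 a b c :: sa) (b :: ta) (a :: ua)
      cases a
      · refine (Runs.loop_false' (w := xs) ?_ ?_ hbody hrest).of_eq ?_ ?_
        · rfl
        · simp
        · simp [sbL1]
        · simp; omega
      · refine (Runs.loop_true' (w := xs) ?_ ?_ hbody hrest).of_eq ?_ ?_
        · rfl
        · simp
        · simp [sbL1]
        · simp; omega

/-- Simulation of the body of the second subtraction loop. [folklore] -/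
theorem runs_subBody2 (b c : Bool) (ys z sa ta ua g : List Bool) :
    Runs (subBody2 b) (file [] ys z sa ta ua (flag c) g)
      (file [] ys z sa (b :: ta) ua (flag (c || b)) g) 4 := by
  have h1 : Runs (push .t b) (file [] ys z sa ta ua (flag c) g) (file [] ys z sa (b :: ta) ua (flag c) g) 1 :=
    Runs.push' (by simp)
  unfold subBody2
  cases b
  · exact (h1.seq (Runs.skip _)).of_eq (by simp) (by norm_num)
  · exact (h1.seq (runs_setTrue_f _ _ _ _ _ _ _ c)).of_eq (by simp) (by norm_num)

/-- Simulation of the second subtraction loop. [folklore] -/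
theorem runs_subLoop2 (ys : List Bool) (c : Bool) (sa ta ua z g : List Bool) :
    Runs subLoop2 (file [] ys z sa ta ua (flag c) g)
      (file [] [] z sa (sbL2 ys c ta).1 ua (flag (sbL2 ys c ta).2) g) (6 * ys.length + 1) := by
  induction ys generalizing c ta with
  | nil => exact (Runs.loop_nil _ _ (by rfl)).of_eq (by simp [sbL2]) (by simp)
  | cons b ys ih =>
    have hbody := runs_subBody2 b c ys z sa ta ua g
    have hrest := ih (c || b) (b :: ta)
    cases b
    · refine (Runs.loop_false' (w := ys) ?_ ?_ hbody hrest).of_eq ?_ ?_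
      · rfl
      · simp
      · simp [sbL2]
      · simp; omega
    · refine (Runs.loop_true' (w := ys) ?_ ?_ hbody hrest).of_eq ?_ ?_
      · rfl
      · simp
      · simp [sbL2]
      · simp; omega

/-- The first loop saves the consumed bits of `y`, reversed. [folklore] -/
theorem sbL1_ta (xs ys : List Bool) (c : Bool) (sa ta ua : List Bool) :
    (sbL1 xs ys c sa ta ua).2.1 = (ys.take xs.length).reverse ++ ta := by
  induction xs generalizing ys c sa ta ua with
  | nil => simp [sbL1]
  | cons a xs ih => cases ys <;> simp [sbL1, ih]

/-- The first loop saves the bits of `x`, reversed. [folklore] -/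
theorem sbL1_ua (xs ys : List Bool) (c : Bool) (sa ta ua : List Bool) :
    (sbL1 xs ys c sa ta ua).2.2.1 = xs.reverse ++ ua := by
  induction xs generalizing ys c sa ta ua with
  | nil => simp [sbL1]
  | cons a xs ih => cases ys <;> simp [sbL1, ih]

/-- The first loop emits one difference bit per bit of `x`. [folklore] -/
theorem sbL1_length (xs ys : List Bool) (c : Bool) (sa ta ua : List Bool) :
    (sbL1 xs ys c sa ta ua).1.length = sa.length + xs.length := by
  induction xs generalizing ys c sa ta ua with
  | nil => simp [sbL1]
  | cons a xs ih => cases ys <;> simp [sbL1, ih] <;> omega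

/-- **Value invariant of the first subtraction loop** (ripple-borrow subtraction).
[Knuth 1998, §4.3.1, Algorithm S (correctness)] [folklore] -/
theorem sbL1_val (xs ys : List Bool) (c : Bool) (sa ta ua : List Bool) :
    bitsToNat (sbL1 xs ys c sa ta ua).1.reverse + 2 ^ sa.length * (bitsToNat (ys.take xs.length) + c.toNat) =
      bitsToNat sa.reverse + 2 ^ sa.length * bitsToNat xs +
        2 ^ (sbL1 xs ys c sa ta ua).1.length * ((sbL1 xs ys c sa ta ua).2.2.2).toNat := by
  induction xs generalizing ys c sa ta ua with
  | nil => simp [sbL1]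
  | cons a xs ih =>
    have key : ∀ b, 2 ^ sa.length * (Bool.xor3 a b c).toNat + 2 ^ sa.length * b.toNat + 2 ^ sa.length * c.toNat =
        2 ^ sa.length * a.toNat + 2 ^ sa.length * 2 * (bbor a b c).toNat := fun b => by
      have := congrArg (2 ^ sa.length * ·) (xor3_add_bbor a b c)
      simp only [mul_add] at this
      simpa [Nat.mul_assoc, Nat.mul_left_comm] using this
    cases ys with
    | nil =>
      rw [sbL1]
      have ih' := ih [] (bbor a false c) (Bool.xor3 a false c :: sa) ta (a :: ua)
      simp only [List.length_cons, List.reverse_cons, bitsToNat_append, List.length_reverse,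
        List.take_nil, bitsToNat_nil, bitsToNat_cons, pow_succ, mul_add, mul_zero, add_zero,
        zero_add] at ih' ⊢
      have := key false
      simp only [Bool.toNat_false, mul_zero, add_zero] at this
      simp only [Nat.mul_assoc, Nat.mul_left_comm (2 ^ sa.length) 2] at this ih' ⊢
      omega
    | cons b ys =>
      rw [sbL1]
      have ih' := ih ys (bbor a b c) (Bool.xor3 a b c :: sa) (b :: ta) (a :: ua)
      simp only [List.length_cons, List.reverse_cons, bitsToNat_append, List.length_reverse,
        List.take_succ_cons, bitsToNat_cons, pow_succ, mul_add, bitsToNat_nil, mul_zero,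
        add_zero] at ih' ⊢
      have := key b
      simp only [Nat.mul_assoc, Nat.mul_left_comm (2 ^ sa.length) 2] at this ih' ⊢
      omega

/-- The second loop saves the bits of `y`, reversed. [folklore] -/
theorem sbL2_ta (ys : List Bool) (c : Bool) (ta : List Bool) : (sbL2 ys c ta).1 = ys.reverse ++ ta := by
  induction ys generalizing c ta with
  | nil => simp [sbL2]
  | cons b ys ih => simp [sbL2, ih]

/-- The second loop's borrow: the incoming borrow, or a set bit among the remaining bits of `y`.
[folklore] -/
theorem sbL2_borrow (ys : List Bool) (c : Bool) (ta : List Bool) :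
    (sbL2 ys c ta).2 = (c || !decide (bitsToNat ys = 0)) := by
  induction ys generalizing c ta with
  | nil => simp [sbL2]
  | cons b ys ih =>
    rw [sbL2, ih]
    cases b <;> cases c <;> simp

/-- The difference has as many bits as `x`. [folklore] -/
theorem length_subRes (xs ys : List Bool) : (subRes xs ys).length = xs.length := by
  simp [subRes, sbL1_length]

/-- **The borrow is the comparison**: `subBorrow x y` is set iff `x < y`.
[Knuth 1998, §4.3.1, Algorithm S] [folklore] -/
theorem subBorrow_iff (xs ys : List Bool) : subBorrow xs ys = decide (bitsToNat xs < bitsToNat ys) := by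
  have h1 := sbL1_val xs ys false [] [] []
  have h1l := sbL1_length xs ys false [] [] []
  have hsplit := bitsToNat_take_add_drop ys xs.length
  have hlt := bitsToNat_lt (sbL1 xs ys false [] [] []).1.reverse
  unfold subBorrow
  rw [sbL2_borrow]
  generalize sbL1 xs ys false [] [] [] = r₁ at h1 h1l hlt ⊢
  obtain ⟨s₁, t₁, u₁, c₁⟩ := r₁
  simp only [List.reverse_nil, bitsToNat_nil, List.length_nil, pow_zero, one_mul, zero_add,
    Bool.toNat_false, add_zero, List.length_reverse] at h1 h1l hlt ⊢
  rw [h1l] at h1 hlt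
  have hP : 0 < 2 ^ xs.length := Nat.two_pow_pos _
  cases c₁
  · simp only [Bool.toNat_false, mul_zero, add_zero, Bool.false_or] at h1 ⊢
    by_cases h0 : bitsToNat (List.drop xs.length ys) = 0
    · simp only [h0, decide_true, Bool.not_true, mul_zero, add_zero] at hsplit ⊢
      symm; rw [decide_eq_false_iff_not]; omega
    · simp only [h0, decide_false, Bool.not_false]
      symm; rw [decide_eq_true_iff]
      have : 1 ≤ bitsToNat (List.drop xs.length ys) := Nat.pos_of_ne_zero h0
      nlinarith
  · simp only [Bool.toNat_true, mul_one, Bool.true_or] at h1 ⊢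
    symm; rw [decide_eq_true_iff]
    nlinarith

/-- **The difference is correct** when there is no borrow. [Knuth 1998, §4.3.1, Algorithm S]
[folklore] -/
theorem bitsToNat_subRes (xs ys : List Bool) (h : bitsToNat ys ≤ bitsToNat xs) :
    bitsToNat (subRes xs ys) = bitsToNat xs - bitsToNat ys := by
  have hb := subBorrow_iff xs ys
  have h1 := sbL1_val xs ys false [] [] []
  have h1l := sbL1_length xs ys false [] [] []
  have hsplit := bitsToNat_take_add_drop ys xs.length
  have hlt := bitsToNat_lt (sbL1 xs ys false [] [] []).1.reverse
  unfold subBorrow at hb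
  rw [sbL2_borrow] at hb
  unfold subRes
  generalize sbL1 xs ys false [] [] [] = r₁ at h1 h1l hlt hb ⊢
  obtain ⟨s₁, t₁, u₁, c₁⟩ := r₁
  simp only [List.reverse_nil, bitsToNat_nil, List.length_nil, pow_zero, one_mul, zero_add,
    Bool.toNat_false, add_zero, List.length_reverse] at h1 h1l hlt hb ⊢
  rw [h1l] at h1 hlt
  have hP : 0 < 2 ^ xs.length := Nat.two_pow_pos _
  cases c₁
  · simp only [Bool.toNat_false, mul_zero, add_zero, Bool.false_or] at h1 hb
    by_cases h0 : bitsToNat (List.drop xs.length ys) = 0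
    · rw [h0, mul_zero, add_zero] at hsplit
      omega
    · simp [h0] at hb; omega
  · simp at hb; omega

/-- **Simulation of `sub`** (see `sub`), in `16(|x| + |y|) + 12` steps.
[Knuth 1998, §4.3.1, Algorithm S] [folklore] -/
theorem runs_sub (xs ys z : List Bool) :
    Runs sub (file xs ys z [] [] [] [] [])
      (file (bif subBorrow xs ys then xs else subRes xs ys) ys z [] [] [] [] (flag !subBorrow xs ys))
      (16 * (xs.length + ys.length) + 12) := by
  have h1 := runs_subLoop1 xs ys false [] [] [] z []
  rw [flag_false] at h1
  set r₁ := sbL1 xs ys false [] [] [] with hr₁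
  have h2 := runs_subLoop2 (ys.drop xs.length) r₁.2.2.2 r₁.1 r₁.2.1 r₁.2.2.1 z []
  set r₂ := sbL2 (ys.drop xs.length) r₁.2.2.2 r₁.2.1 with hr₂
  have hta : r₂.1 = ys.reverse := by
    rw [hr₂, sbL2_ta, hr₁, sbL1_ta, List.append_nil, ← List.reverse_append, List.take_append_drop]
  have hua : r₁.2.2.1 = xs.reverse := by rw [hr₁, sbL1_ua, List.append_nil]
  have hborrow : r₂.2 = subBorrow xs ys := rfl
  have hres : r₁.1 = (subRes xs ys).reverse := by simp [subRes, hr₁]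
  have hlen1 : r₁.1.length = xs.length := by rw [hres, List.length_reverse, length_subRes]
  -- the two finishing branches
  have hfinT : Runs (pour .u .x ;; clear .s) (file [] [] z r₁.1 r₂.1 r₁.2.2.1 [] [])
      (file xs [] z [] r₂.1 [] [] []) ((3 * xs.length + 1) + (2 * xs.length + 1)) := by
    have hp : Runs (pour .u .x) (file [] [] z r₁.1 r₂.1 r₁.2.2.1 [] [])
        (file xs [] z r₁.1 r₂.1 [] [] []) (3 * xs.length + 1) :=
      (runs_pour (a := AReg.u) (b := AReg.x) (by decide) _).of_eq (by simp [hua]) (by simp [hua])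
    have hc : Runs (clear .s) (file xs [] z r₁.1 r₂.1 [] [] []) (file xs [] z [] r₂.1 [] [] [])
        (2 * xs.length + 1) := (runs_clear AReg.s _).of_eq (by simp) (by simp [hlen1])
    exact hp.seq hc
  have hfinN : Runs (pour .s .x ;; clear .u ;; push .g true) (file [] [] z r₁.1 r₂.1 r₁.2.2.1 [] [])
      (file (subRes xs ys) [] z [] r₂.1 [] [] [true]) ((3 * xs.length + 1) + ((2 * xs.length + 1) + 1)) := by
    have hp : Runs (pour .s .x) (file [] [] z r₁.1 r₂.1 r₁.2.2.1 [] [])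
        (file (subRes xs ys) [] z [] r₂.1 r₁.2.2.1 [] []) (3 * xs.length + 1) :=
      (runs_pour (a := AReg.s) (b := AReg.x) (by decide) _).of_eq (by simp [hres]) (by simp [hlen1])
    have hc : Runs (clear .u) (file (subRes xs ys) [] z [] r₂.1 r₁.2.2.1 [] [])
        (file (subRes xs ys) [] z [] r₂.1 [] [] []) (2 * xs.length + 1) :=
      (runs_clear AReg.u _).of_eq (by simp) (by simp [hua])
    have hg : Runs (push .g true) (file (subRes xs ys) [] z [] r₂.1 [] [] [])
        (file (subRes xs ys) [] z [] r₂.1 [] [] [true]) 1 := Runs.push' (by simp)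
    exact hp.seq (hc.seq hg)
  have h3 : Runs (pop .f (pour .u .x ;; clear .s) (pour .u .x ;; clear .s) (pour .s .x ;; clear .u ;; push .g true))
      (file [] [] z r₁.1 r₂.1 r₁.2.2.1 (flag r₂.2) [])
      (file (bif subBorrow xs ys then xs else subRes xs ys) [] z [] r₂.1 [] [] (flag !subBorrow xs ys))
      (5 * xs.length + 3 + 2) := by
    rw [hborrow]
    cases hb : subBorrow xs ys
    · exact (Runs.pop_nil _ _ (R := file [] [] z r₁.1 r₂.1 r₁.2.2.1 (flag false) []) rfl hfinN).of_eq
        (by simp) (by omega)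
    · exact (Runs.pop_true' _ _ (R := file [] [] z r₁.1 r₂.1 r₁.2.2.1 (flag true) []) (w := []) rfl
        (by simp) hfinT).of_eq (by simp) (by omega)
  have h4 : Runs (pour .t .y)
      (file (bif subBorrow xs ys then xs else subRes xs ys) [] z [] r₂.1 [] [] (flag !subBorrow xs ys))
      (file (bif subBorrow xs ys then xs else subRes xs ys) ys z [] [] [] [] (flag !subBorrow xs ys))
      (3 * ys.length + 1) :=
    (runs_pour (a := AReg.t) (b := AReg.y) (by decide) _).of_eq (by simp [hta]) (by simp [hta])
  refine (h1.seq (h2.seq (h3.seq h4))).of_eq rfl ?_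
  have : (ys.drop xs.length).length ≤ ys.length := by simp
  nlinarith [this]

end Com

end Literature.Computability.Complexity
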